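import Literature.AlgebraicGeometry.HilbertScheme.TransferOperatorSuperCommutators
import Literature.AlgebraicGeometry.HilbertScheme.HeisenbergMultiPointOperators
import HarnessLib

/-!
# The Chern character operators are the zero-modes of the `W` algebra: Li–Qin–Wang, IMRN 2002, Thm. 4.6
(closed form), Lehn's derivative formula and LQW's bracket formula — predicate + named fact (abelian surfaces)

Layer `Literature/AlgebraicGeometry/HilbertScheme`; sequel of `ChernCharacterOperators` (the hypothesis structure
`𝔊 : ChernCharacterOperators hS H`: Nakajima's `𝔮ₘ(α)` and the classes `G_k(γ, n)`, `𝔊ₖ(γ) = ⨁ₙ G_k(γ, n) ∪ ·`,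
`𝔡 = 𝔊₁(1_S)`) and of `HeisenbergMultiPointOperators` (the words `multiPointOp` = `𝔮_{m₁}⋯𝔮_{m_k}(τ_{k*}γ)`, `zeroMode` =
`Σ_{ℓ(λ)=k,|λ|=0} 𝔞_λ(τ_*γ)/λ^!`, `virasoroOp` = `𝔏ₙ(γ)`).  Typed by the literature-typing seat `hodge-lit-lqw` (cell
`hodge-kum4`, lane (V)) as the PRINT identification input of the lane's closure statement `LefschetzGenerationHilb n`
and of its computational certificates `Literature/Computation/AbelianHilbFock/*` (which cite "Li–Qin–Wang IMRN 2002
Thm 4.6 with `K = 0 = e`" for the identification of their operators `𝔊₀(e_I)`, `𝔊₁(1)`, `𝔊₁(e_i)` with cup products).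

WHAT IS TYPED.  For a smooth projective surface `S` with NUMERICALLY TRIVIAL CANONICAL CLASS and TRIVIAL EULER CLASS —
an abelian surface (`K_A = 0`, `e(A) = χ_top(A)·pt = 0`), the case every consumer needs — the three printed identities
tying ALL the Chern character operators to the Heisenberg operators, as a `Prop`-valued predicate
`ChernCharacterOperators.IsWZeroModes 𝔊` on an instance of the interface:

* (L) **Lehn's derivative formula** (LQW Math. Ann. Thm. 2.16 (iv) = Lehn Thm. 3.10; IMRN Thm. 3.1 (iii)):
  `[𝔡, 𝔮ₙ(γ)] = n · 𝔏ₙ(γ) + n(|n|−1)/2 · 𝔮ₙ(K_S γ)`, whose `K`-term vanishes when `K_S` is numerically trivial: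
  `𝔡 𝔮ₙ(γ) − 𝔮ₙ(γ) 𝔡 = n · 𝔏ₙ(γ)` (`𝔡` is even, so the super-bracket is the commutator).  This pins `𝔡` (the typed axiom
  `boundary_bracket` of the interface omits the mode pairs `n + m = 0`, whose printed right-hand side carries `K_S`).
* (G) **Li–Qin–Wang's bracket formula** (Math. Ann. Lemma 5.8 (5.9); IMRN Thm. 3.1 (v)), valid for EVERY surface:
  `[𝔊ₖ(γ), 𝔮₁(β)] = (1/k!) · 𝔮₁^{(k)}(γβ)`, `𝔣^{(k)} = ad(𝔡)ᵏ 𝔣`.  With `𝔊ₖ(γ)|0⟩ = 0` and `𝔊ₖ(γ)' = 0` this determines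
  `𝔊ₖ(γ)` (IMRN Lemma 4.5 (ii)).
* (W) **Li–Qin–Wang, IMRN 2002 Thm. 4.6** — "Let `k ≥ 0`, and `α ∈ 𝔄_X` [`= {α | K_X α = 0}`]. Then `𝔊ₖ(α)` is equal to
  `−Σ_{ℓ(λ)=k+2, |λ|=0} (1/λ^!) 𝔞_λ(τ_*α) + Σ_{ℓ(λ)=k, |λ|=0} (s(λ)−2)/(24 λ^!) 𝔞_λ(τ_*(eα))`" — with `𝔄_X = H*(X)` and the
  Euler term absent (`e = 0`): `𝔊ₖ(γ) = −zeroMode (k+2) γ` for all `k ≥ 0` and all `γ`.  The case `k = 0` is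
  `𝔊₀(γ) = −𝔏₀(γ) = −Σ_{n>0} 𝔮ₙ𝔮₋ₙ(τ_{2*}γ)` (LQW (5.6)/Thm. 5.13 (iv), Lehn), `k = 1`, `γ = 1_S` is the cubic form of Lehn's
  boundary operator `𝔡 = −(1/6) Σ_{a+b+c=0} :𝔮ₐ𝔮_b𝔮_c:(τ_{3*}1_S)` for `K = 0 = e`.

NAMED FACT `LiQinWang2002W_chernCharacter_zeroModes_abelianSurface`: for an abelian surface and every choice `H` of its
Hilbert schemes there is an instance `𝔊 : ChernCharacterOperators hS H` with `𝔊.IsVertexExpressible ∧ 𝔊.IsWZeroModes`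
(EXISTENTIAL INTERFACE RENDERING, as the prequels: the witness is the geometric one — Nakajima's correspondences and the
Chern characters of `𝒪_{𝒵ₙ}` — for which (L), (G), (W) and the top nested brackets (`IsVertexExpressible`, Math. Ann.
Thm. 4.10 (i)) are the cited theorems; one fact, one witness, so that all printed identities hold for the SAME operators).
It implies the prequel's `LiQinWang2002W_chernCharacter_abelianSurface` (`…_of_zeroModes`).  Net debt +1 (REFEREED).

PROVED HERE (every instance, no fact): the case `k = 0`, `γ ∈ H²(S)` of (W) — `𝔊₀(α) = −zeroMode 2 α` — IS the tree's
theorem `ChernCharacterOperators.cupOperator_zero_eq_transferOp_super` (Lehn's `𝔊₀(α) = T(L_α)`, from the axiom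
`G_zero_bracket` by cyclicity) read through `zeroMode_two_eq_neg_transferOp`
(`cupOperator_zero_eq_neg_zeroMode_two`): the typed closed form AGREES, where the tree can already decide it, with what
the interface proves — the anchor for the sign and ordering conventions of `zeroMode` (creation operators left, Casimir
dictionary of `HeisenbergMultiPointOperators`).  Under the predicate: `𝔡 = −zeroMode 3 (1_S)` and `𝔊₀(γ) = T(γ ∪ ·)` for
`γ` of every degree.

## Sources (read AT SOURCE this session; PDF pages of the materialised arXiv texts)

* W.-P. Li, Z. Qin, W. Wang, *Hilbert schemes and W algebras*, Int. Math. Res. Not. 2002:27, 1427–1456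
  (arXiv:math/0111047) [`LiQinWang2002W`; REFEREED]: Thm. 3.1 p. 6 ("(iii) `𝔞ₙ'(α) = n · 𝔏ₙ(α) − n(|n|−1)/2 · 𝔞ₙ(K_X α)`";
  "(v) `[𝔊ₖ(α), 𝔞₋₁(β)] = (1/k!) · 𝔞₋₁^{(k)}(αβ)`"; "`𝔣' = [𝔡, 𝔣]`"; `𝔞₋ₙ = ` creation, i.e. `𝔞ₙ = 𝔮₋ₙ`), Def. 4.1 p. 8
  (`λ`, `ℓ(λ)`, `|λ|`, `s(λ)`, `λ^!`, `𝔞_λ(τ_*α)`, `𝔄_X`), Lemma 4.5 (ii) p. 10 (uniqueness: `𝔣ᵢ|0⟩ = 0`, `𝔣ᵢ' = 0`, same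
  `[𝔣ᵢ, 𝔞₋₁(α)]` `⇒ 𝔣₁ = 𝔣₂`), **Thm. 4.6 p. 10** (verbatim above; `[corpus: paper:arxiv-math_0111047 p0010:L125–L133]`),
  proof of Thm. 4.7 p. 11 ("by the formula (5.6) in [LQW1], we have `𝔊₀(α) = −𝔏₀(α) = −Σ_{ℓ(λ)=2,|λ|=0} (1/λ^!) 𝔞_λ(τ_*α)`.
  So our theorem is true for `k = 0`").
* W.-P. Li, Z. Qin, W. Wang, Math. Ann. 324 (2002) 105–133 (arXiv:math/0009132) [`LiQinWang2002`; REFEREED]: (2.13)–(2.15)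
  p. 5 (`𝔏ₙ`, `𝔡 = ⨁ₙ c₁(p₁*𝒪_{𝒵ₙ})`, `𝔣' = [𝔡, 𝔣]`), **Thm. 2.16 (iv) p. 5** ("`𝔮ₙ'(α) = n · 𝔏ₙ(α) + n(|n|−1)/2 𝔮ₙ(K_X α)`",
  "obtained by Lehn [Leh]"; `[corpus: paper:arxiv-math_0009132 p0005:L66–L75]`), (5.6)–(5.7) p. 12, **Lemma 5.8 (5.9)
  p. 12** ("`[𝔊ₖ(γ), 𝔮₁(α)] = (1/k!) · 𝔮₁^{(k)}(γα)`"; `[corpus: paper:arxiv-math_0009132 p0012:L82–L91]`), Thm. 4.10 (i)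
  p. 10 (the top nested brackets, prequel's `IsVertexExpressible`).
* M. Lehn, Invent. Math. 136 (1999) 157–207 [`Lehn1999`; REFEREED]: Thm. 3.10 (the derivative formula with its `K`-term).

## Rendering and faithfulness

* The Casimir tensor `C` (hypotheses `C ∈ evenTensorSpan`, `IsCasimir ℂ (poincarePairing hS) C`, as in the D3 theorem
  `isDualLefschetz_transferOp` and in `LefschetzGenerationHilb`): (L) and (W) mention `τ_{2*}`, `τ_{k*}`, rendered through
  `C` (dictionary in `HeisenbergMultiPointOperators`); the identities are stated for EVERY even Casimir tensor — there is
  exactly one (Poincaré duality; `PoincareCasimirElement.exists_isCasimir_mem_evenTensorSpan` provides it), the Künneth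
  class of the diagonal, so this quantifier is not a strengthening.
* SCOPE = abelian surfaces (FAITHFUL there: `K = 0`, `e = 0`, `𝔄_X = H*(X)`).  TODO(general form): surfaces with `K_S`
  numerically trivial and `e ≠ 0` (K3, Enriques: the Euler term of Thm. 4.6 and `e` in Thm. 3.1 (iv)), Thm. 4.7 (arbitrary
  `α`, universal constants `g_ε(λ)`), Lehn's `K`-term — the tree has no canonical / Euler class of a surface on
  `complexBetti`.  (G) holds for every surface; it is recorded here only inside the abelian-surface fact.
* Typed ≠ proved: (L), (G), (W) are hypotheses on an instance, discharged by no construction in the tree; the `k = 0`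
  anchor is proved.  Nothing in this file asserts L1 / `LefschetzGenerationHilb n` / MODEL_X / HC_Kum4Type / HC.

## Not here

The derivation (W) ⇐ (L) + (G) + Heisenberg (IMRN Thm. 4.2, Lemma 3.2, Lemma 4.5 — pure algebra, the paper's proof);
the `W` algebra `𝒲_X` (IMRN §5); Göttsche's Betti numbers (sibling `HilbertSchemeBettiNumbers`).
-/

noncomputable section

open DirectSum TensorProduct
open Literature.AlgebraicTopology.SingularHomology
open Literature.AlgebraicGeometry.Motives (SchemeOver ComplexPoints IsSmoothProjective AbelianVariety)
open Literature.AlgebraicGeometry.Hyperkaehler (totalCohomology ofDegree totalCup totalLefschetz)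
open Literature.AlgebraicGeometry.HodgeTheory (complexBetti)

namespace Literature.AlgebraicGeometry.HilbertScheme

variable {S : SchemeOver ℂ} {hS : IsSmoothProjective 2 S} {H : HilbertSchemesOfPoints S}

namespace ChernCharacterOperators

/-- **The Chern character operators of `𝔊` are the `W`-algebra zero-modes** (surfaces with `K_S ≡ 0`, `e(S) = 0`):
(L) Lehn's derivative formula `[𝔡, 𝔮ₙ(γ)] = n 𝔏ₙ(γ)` (Math. Ann. Thm. 2.16 (iv), `K`-term zero); (G) LQW's bracket
formula `[𝔊ₖ(γ), 𝔮₁(β)] = (1/k!) ad(𝔡)ᵏ 𝔮₁(γβ)` (Math. Ann. Lemma 5.8); (W) IMRN Thm. 4.6 with `𝔄_X = H*(X)` and no Euler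
term: `𝔊ₖ(γ) = −Σ_{ℓ(λ)=k+2, |λ|=0} 𝔞_λ(τ_*γ)/λ^!` — for every even Casimir tensor `C` of `∫_S(· ∪ ·)` (there is exactly
one).  [cite: LiQinWang2002W, Thm. 3.1 (iii) and (v) p. 6, Thm. 4.6 p. 10]
[cite: LiQinWang2002, Thm. 2.16 (iv) p. 5 and Lemma 5.8 (5.9) p. 12] [cite: Lehn1999, Thm. 3.10] -/
structure IsWZeroModes (𝔊 : ChernCharacterOperators hS H) : Prop where
  /-- (L) `𝔡 𝔮ₙ(γ) − 𝔮ₙ(γ) 𝔡 = n · 𝔏ₙ(γ)` (Lehn; `K_S` numerically trivial). -/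
  boundary_commute : ∀ C : totalCohomology ℂ (ComplexPoints S) ⊗[ℂ] totalCohomology ℂ (ComplexPoints S),
    C ∈ evenTensorSpan ℂ (coeffFamily S) → IsCasimir ℂ (poincarePairing hS) C →
    ∀ (n : ℤ) (γ : totalCohomology ℂ (ComplexPoints S)),
      𝔊.boundaryOperator * 𝔊.q n γ - 𝔊.q n γ * 𝔊.boundaryOperator =
        (n : ℂ) • virasoroOp ℂ 𝔊.q (totalCup ℂ (ComplexPoints S)) C n γ
  /-- (G) `[𝔊ₖ(γ), 𝔮₁(β)] = (1/k!) · ad(𝔡)ᵏ (𝔮₁(γ ∪ β))` for homogeneous `γ ∈ Hˢ(S)`, `β ∈ Hʲ(S)` (super-bracket with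
  parities `s`, `j`; `𝔡` is even). -/
  cupOperator_bracket_q_one : ∀ (k s : ℕ) (γ : complexBetti S s) (j : ℕ) (β : complexBetti S j),
    superBracket ℂ (𝔊.cupOperator k (ofDegree ℂ (ComplexPoints S) s γ)) (𝔊.q 1 (ofDegree ℂ (ComplexPoints S) j β)) s j =
      ((k.factorial : ℂ)⁻¹) •
        (fun f : Module.End ℂ (fockSpace H) ↦ 𝔊.boundaryOperator * f - f * 𝔊.boundaryOperator)^[k]
          (𝔊.q 1 (totalCup ℂ (ComplexPoints S) (ofDegree ℂ (ComplexPoints S) s γ) (ofDegree ℂ (ComplexPoints S) j β)))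
  /-- (W) IMRN Thm. 4.6 (`K = 0`, `e = 0`): `𝔊ₖ(γ) = −Σ_{ℓ(λ)=k+2, |λ|=0} 𝔞_λ(τ_*γ)/λ^!` for all `k ≥ 0`, `γ ∈ H*(S)`. -/
  cupOperator_eq_neg_zeroMode : ∀ C : totalCohomology ℂ (ComplexPoints S) ⊗[ℂ] totalCohomology ℂ (ComplexPoints S),
    C ∈ evenTensorSpan ℂ (coeffFamily S) → IsCasimir ℂ (poincarePairing hS) C →
    ∀ (k : ℕ) (γ : totalCohomology ℂ (ComplexPoints S)),
      𝔊.cupOperator k γ = -zeroMode ℂ 𝔊.q (totalCup ℂ (ComplexPoints S)) C (k + 2) γ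

/-! ### Unconditional anchor: the case `k = 0`, `γ ∈ H²`, of (W) is a theorem of the interface -/

/-- **`𝔊₀(α) = −Σ_{ℓ(λ)=2, |λ|=0} 𝔞_λ(τ_*α)/λ^!` for `α ∈ H²(S)`, for EVERY instance and every smooth projective surface**
(no fact): Lehn's `𝔊₀(α) = T(L_α)` — the tree's `cupOperator_zero_eq_transferOp_super`, proved from `G_zero_bracket`
by cyclicity — is literally the `k = 0` case of Li–Qin–Wang's closed formula in the rendering of this layer
(`zeroMode_two_eq_neg_transferOp`).  [cite: LiQinWang2002W, Thm. 4.6 (k = 0) p. 10 and proof of Thm. 4.7 p. 11]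
[cite: LiQinWang2002, (5.6) and Thm. 5.13 (iv)] [cite: Oberdieck2021, §3.1–3.2] -/
theorem cupOperator_zero_eq_neg_zeroMode_two (𝔊 : ChernCharacterOperators hS H)
    {C : totalCohomology ℂ (ComplexPoints S) ⊗[ℂ] totalCohomology ℂ (ComplexPoints S)}
    (hCg : C ∈ evenTensorSpan ℂ (coeffFamily S)) (hC : IsCasimir ℂ (poincarePairing hS) C) (α : complexBetti S 2) :
    𝔊.cupOperator 0 (ofDegree ℂ (ComplexPoints S) 2 α) =
      -zeroMode ℂ 𝔊.q (totalCup ℂ (ComplexPoints S)) C 2 (ofDegree ℂ (ComplexPoints S) 2 α) := by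
  rw [𝔊.cupOperator_zero_eq_transferOp_super hCg hC α, zeroMode_two_eq_neg_transferOp,
    Hyperkaehler.totalLefschetz_eq_totalCup]
  exact (neg_neg (transferOp ℂ 𝔊.q C 1
    (totalCup ℂ (ComplexPoints S) (ofDegree ℂ (ComplexPoints S) 2 α)))).symm

namespace IsWZeroModes

variable {𝔊 : ChernCharacterOperators hS H}

/-- (W) at `k = 0`: **`𝔊₀(γ) = −𝔏₀(γ) = −Σ_{n>0} 𝔮ₙ𝔮₋ₙ(τ_{2*}γ)`** for `γ` of every degree (LQW (5.6), Thm. 5.13 (iv)).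
[cite: LiQinWang2002, Thm. 5.13 (iv) p. 13] [cite: LiQinWang2002W, Thm. 4.6 p. 10] -/
theorem cupOperator_zero_eq_neg_virasoro_zero (h : 𝔊.IsWZeroModes)
    {C : totalCohomology ℂ (ComplexPoints S) ⊗[ℂ] totalCohomology ℂ (ComplexPoints S)}
    (hCg : C ∈ evenTensorSpan ℂ (coeffFamily S)) (hC : IsCasimir ℂ (poincarePairing hS) C)
    (γ : totalCohomology ℂ (ComplexPoints S)) :
    𝔊.cupOperator 0 γ = -virasoroOp ℂ 𝔊.q (totalCup ℂ (ComplexPoints S)) C 0 γ := by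
  rw [h.cupOperator_eq_neg_zeroMode C hCg hC 0 γ, virasoroOp_zero_eq_zeroMode_two]

/-- (W) at `k = 0`, transfer form: **`𝔊₀(γ) = T(γ ∪ ·)`** (Oberdieck's transfer with exponent `t = 1`) for `γ` of EVERY
degree — the tree proves this unconditionally for `γ ∈ H²` (`cupOperator_zero_eq_transferOp_super`).
[cite: LiQinWang2002W, Thm. 4.6 p. 10] [cite: Oberdieck2021, §3.2 p. 7] -/
theorem cupOperator_zero_eq_transferOp (h : 𝔊.IsWZeroModes)
    {C : totalCohomology ℂ (ComplexPoints S) ⊗[ℂ] totalCohomology ℂ (ComplexPoints S)}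
    (hCg : C ∈ evenTensorSpan ℂ (coeffFamily S)) (hC : IsCasimir ℂ (poincarePairing hS) C)
    (γ : totalCohomology ℂ (ComplexPoints S)) :
    𝔊.cupOperator 0 γ = transferOp ℂ 𝔊.q C 1 (totalCup ℂ (ComplexPoints S) γ) := by
  rw [h.cupOperator_eq_neg_zeroMode C hCg hC 0 γ, zeroMode_two_eq_neg_transferOp]
  exact neg_neg (transferOp ℂ 𝔊.q C 1 (totalCup ℂ (ComplexPoints S) γ))

/-- (W) at `k = 1`, `γ = 1_S`: **Lehn's boundary operator is the three-point zero-mode**,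
`𝔡 = −Σ_{ℓ(λ)=3, |λ|=0} 𝔞_λ(τ_*1_S)/λ^!` (`= −(1/6) Σ_{a+b+c=0} :𝔮ₐ𝔮_b𝔮_c:(τ_{3*}1_S)`; `K = 0 = e`).
[cite: LiQinWang2002W, Thm. 4.6 (k = 1) p. 10] [cite: LiQinWang2002, (5.7) p. 12] -/
theorem boundaryOperator_eq_neg_zeroMode_three (h : 𝔊.IsWZeroModes)
    {C : totalCohomology ℂ (ComplexPoints S) ⊗[ℂ] totalCohomology ℂ (ComplexPoints S)}
    (hCg : C ∈ evenTensorSpan ℂ (coeffFamily S)) (hC : IsCasimir ℂ (poincarePairing hS) C) :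
    𝔊.boundaryOperator = -zeroMode ℂ 𝔊.q (totalCup ℂ (ComplexPoints S)) C 3 (unitCoeff S) :=
  h.cupOperator_eq_neg_zeroMode C hCg hC 1 (unitCoeff S)

/-- (L) for a CREATION operator, read as Lehn/LQW print it: `𝔮ₙ'(γ) = [𝔡, 𝔮ₙ(γ)] = n · 𝔏ₙ(γ)`.
[cite: LiQinWang2002, Thm. 2.16 (iv) p. 5] [cite: LiQinWang2002W, Thm. 3.1 (iii) p. 6] -/
theorem derivative_q (h : 𝔊.IsWZeroModes)
    {C : totalCohomology ℂ (ComplexPoints S) ⊗[ℂ] totalCohomology ℂ (ComplexPoints S)}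
    (hCg : C ∈ evenTensorSpan ℂ (coeffFamily S)) (hC : IsCasimir ℂ (poincarePairing hS) C) (n : ℤ)
    (γ : totalCohomology ℂ (ComplexPoints S)) :
    𝔊.boundaryOperator * 𝔊.q n γ - 𝔊.q n γ * 𝔊.boundaryOperator =
      (n : ℂ) • virasoroOp ℂ 𝔊.q (totalCup ℂ (ComplexPoints S)) C n γ :=
  h.boundary_commute C hCg hC n γ

/-- (G) at `k = 0`: `[𝔊₀(γ), 𝔮₁(β)] = 𝔮₁(γβ)` — consistent with (indeed the `m = 1` case of) the interface axiom
`G_zero_bracket`. [cite: LiQinWang2002, Lemma 5.8 (5.9) p. 12 and Thm. 5.13 (iv)] -/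
theorem cupOperator_zero_bracket_q_one (h : 𝔊.IsWZeroModes) (s : ℕ) (γ : complexBetti S s) (j : ℕ)
    (β : complexBetti S j) :
    superBracket ℂ (𝔊.cupOperator 0 (ofDegree ℂ (ComplexPoints S) s γ)) (𝔊.q 1 (ofDegree ℂ (ComplexPoints S) j β)) s j =
      𝔊.q 1 (totalCup ℂ (ComplexPoints S) (ofDegree ℂ (ComplexPoints S) s γ) (ofDegree ℂ (ComplexPoints S) j β)) := by
  have := h.cupOperator_bracket_q_one 0 s γ j β
  simpa using this

end IsWZeroModes

/-- (G) at `k = 0` needs no fact: it is the axiom `[𝔊₀(γ), 𝔮₁(β)] = 1 · 𝔮₁(γβ)` of the interface (every surface).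
[cite: LiQinWang2002, Thm. 5.13 (iv) p. 13 and Lemma 5.8 (5.9) p. 12] -/
theorem cupOperator_zero_superBracket_q_one (𝔊 : ChernCharacterOperators hS H) (s : ℕ) (γ : complexBetti S s) (j : ℕ)
    (β : complexBetti S j) :
    superBracket ℂ (𝔊.cupOperator 0 (ofDegree ℂ (ComplexPoints S) s γ)) (𝔊.q 1 (ofDegree ℂ (ComplexPoints S) j β)) s j =
      𝔊.q 1 (totalCup ℂ (ComplexPoints S) (ofDegree ℂ (ComplexPoints S) s γ) (ofDegree ℂ (ComplexPoints S) j β)) := by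
  have h1 := 𝔊.G_zero_bracket s γ 1 j β
  rw [Int.cast_one, one_smul] at h1
  exact h1

end ChernCharacterOperators

/-! ### Named fact -/

/-- **Li–Qin–Wang / Lehn: for an abelian surface the Chern character operators are the `W`-algebra zero-modes.**
For every complex abelian surface `A` and every choice `H` of its Hilbert schemes of points there is an instance
`𝔊 : ChernCharacterOperators hS H` (the geometric one) all of whose operators satisfy the printed identities:
the top nested brackets `[⋯[𝔊ₖ(γ), 𝔮_{m₁}(α₁)],…,𝔮_{m_{k+1}}(α_{k+1})] = −Π(−mᵢ) 𝔮_{Σmᵢ}(γα₁⋯α_{k+1})` (Math. Ann. Thm.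
4.10 (i); `IsVertexExpressible`), Lehn's `[𝔡, 𝔮ₙ(γ)] = n 𝔏ₙ(γ)` (`K_A = 0`), LQW's `[𝔊ₖ(γ), 𝔮₁(β)] = (1/k!) 𝔮₁^{(k)}(γβ)`,
and IMRN Thm. 4.6 "`𝔊ₖ(α) = −Σ_{ℓ(λ)=k+2,|λ|=0} (1/λ^!) 𝔞_λ(τ_*α) + Σ_{ℓ(λ)=k,|λ|=0} (s(λ)−2)/(24λ^!) 𝔞_λ(τ_*(eα))` for
`α ∈ 𝔄_X`" with `𝔄_A = H*(A)`, `e(A) = 0` (`IsWZeroModes`).  REFEREED.  EXISTENTIAL INTERFACE RENDERING; net debt +1;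
implies `LiQinWang2002W_chernCharacter_abelianSurface`.  TODO(general form): `K_S` numerically trivial with `e ≠ 0`;
Thm. 4.7.  [cite: LiQinWang2002W, Thm. 3.1 (iii), (v) p. 6 and Thm. 4.6 p. 10]
[cite: LiQinWang2002, Thm. 2.16 (iv) p. 5, Thm. 4.10 (i) p. 10, Lemma 5.8 (5.9) p. 12] [cite: Lehn1999, Thm. 3.10] -/
def LiQinWang2002W_chernCharacter_zeroModes_abelianSurface : Prop :=
  ∀ (A : AbelianVariety ℂ), A.dim = 2 → ∀ (hS : IsSmoothProjective 2 A.X) (H : HilbertSchemesOfPoints A.X),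
    ∃ 𝔊 : ChernCharacterOperators hS H, 𝔊.IsVertexExpressible ∧ 𝔊.IsWZeroModes

/-- The zero-mode fact implies the prequel's vertex-expressibility fact (forget (L), (G), (W)).
[cite: LiQinWang2002W, Thm. 4.6 p. 10] -/
theorem liQinWang2002W_chernCharacter_abelianSurface_of_zeroModes
    (h : LiQinWang2002W_chernCharacter_zeroModes_abelianSurface) : LiQinWang2002W_chernCharacter_abelianSurface :=
  fun A hA hS H ↦ (h A hA hS H).imp fun _ h𝔊 ↦ h𝔊.1

/-- Under the fact: on `A^[n]`, cup product with the divisor class is `−𝔏₀`, Lehn's boundary operator is the three-point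
zero-mode, and every `𝔊ₖ(γ)` is the `(k+2)`-point zero-mode — the operator set of the lane-V engine
(`Literature/Computation/AbelianHilbFock/Fock.lean`: `𝔊₀(e_I)`, `𝔊₁(1)`, `𝔊₁(e_i)`) in the typed interface.
[cite: LiQinWang2002W, Thm. 4.6 p. 10] -/
theorem LiQinWang2002W_chernCharacter_zeroModes_abelianSurface.exists_eq_neg_zeroMode
    (h : LiQinWang2002W_chernCharacter_zeroModes_abelianSurface) (A : AbelianVariety ℂ) (hA : A.dim = 2)
    (hS : IsSmoothProjective 2 A.X) (H : HilbertSchemesOfPoints A.X)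
    {C : totalCohomology ℂ (ComplexPoints A.X) ⊗[ℂ] totalCohomology ℂ (ComplexPoints A.X)}
    (hCg : C ∈ evenTensorSpan ℂ (coeffFamily A.X)) (hC : IsCasimir ℂ (poincarePairing hS) C) :
    ∃ 𝔊 : ChernCharacterOperators hS H, 𝔊.IsVertexExpressible ∧
      (∀ (k : ℕ) (γ : totalCohomology ℂ (ComplexPoints A.X)),
        𝔊.cupOperator k γ = -zeroMode ℂ 𝔊.q (totalCup ℂ (ComplexPoints A.X)) C (k + 2) γ) ∧
      𝔊.boundaryOperator = -zeroMode ℂ 𝔊.q (totalCup ℂ (ComplexPoints A.X)) C 3 (unitCoeff A.X) := by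
  obtain ⟨𝔊, hV, hW⟩ := h A hA hS H
  exact ⟨𝔊, hV, hW.cupOperator_eq_neg_zeroMode C hCg hC, hW.boundaryOperator_eq_neg_zeroMode_three hCg hC⟩

end Literature.AlgebraicGeometry.HilbertScheme

end
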